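import Summits.MatrixMultiplication.MatrixMultiplication.Theorems.SubgroupIdentityDesigns.Negative.CornerGrid
import Summits.MatrixMultiplication.MatrixMultiplication.Theorems.SubgroupIdentityDesigns.Negative.SylowFrames

/-!
# The two-p-member KERNEL LAW for level-1 witnesses (negative lemmas for the crux
# `SubgroupIdentityDesigns`, stmt-MatrixMultiplication-14079) — VALUE = THEOREM (all p), NOT
# summit progress; the crux stays open.

A structural law for the `(m,k) = (2,1)` census, valid for EVERY prime `p`, obtained by combining
the Sylow frame (`SylowFrames.exists_borel_frame_of_tpp`) with the corner-grid certificate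
(`CornerGrid.no_idTest_grid_up₁_lo₂`):

**Kernel law.**  Let `(H₁, H₂, H₃)` be subgroup-TPP in `GL_2(𝔽_p)` with `p ∣ |H₁|`, `p ∣ |H₂|`, and
suppose it carries a level-1 identity test.  Conjugate into the Borel frame `H₁' ≤ B⁺ ⊇ U⁺`,
`H₂' ≤ B⁻ ⊇ U⁻`.  Then the diagonal data `D = {diag(a)·diag(b) : a ∈ H₁', b ∈ H₂'}` meets AT MOST
ONE coordinate kernel: either `a₁₁b₁₁ = 1 ⇒ a₀₀b₀₀ = 1` for all `a ∈ H₁'`, `b ∈ H₂'`, or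
`a₀₀b₀₀ = 1 ⇒ a₁₁b₁₁ = 1` for all such `a, b` (`kernel_law_frame`, `kernel_law_of_two_pMembers`,
and `kernel_law_of_levelOne_design` in the crux's vocabulary).  Equivalently one of the two
coordinate characters `D → 𝔽_p^×` is injective, so `D` is cyclic of order dividing `p - 1`.

Ingredients: transport of identity tests under conjugation (`idTest_map_conj`), diagonal parts of
frame elements lie in the members (`exists_diag_mem_of_upper/lower`, because `U^± ≤ H'ᵢ`).
Honest scope: this is a CONSTRAINT on witnesses, not a no-go; the same-corner coprime frames
(`D ⊆ {diag(1,·)}` or `D ⊆ {diag(·,1)}`… more generally `D` injecting into one coordinate) remain.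
-/

set_option linter.dupNamespace false

noncomputable section

open scoped BigOperators Classical
open Summit.MatrixMultiplication.MatrixMultiplication.Theorems.LieRankDesigns.Negative
  (GLm Mat fourierFn)
open Summit.MatrixMultiplication.MatrixMultiplication.Theorems.LevelOneGL2Designs.Negative
  (levelSubmodule levelSubmodule_bi_inv)

namespace Summit.MatrixMultiplication.MatrixMultiplication.Theorems.SubgroupIdentityDesigns.Negative

section KernelLaw

open Literature.Barriers.MatrixMultiplication (SubgroupTPP)

variable {p : ℕ} [hp : Fact p.Prime]

/-- **Transport.**  A level-1 identity test for `(H₁, H₂, H₃)` yields one for the conjugated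
triple `(c⁻¹H₁c, c⁻¹H₂c, c⁻¹H₃c)` (bi-invariance of the level-1 test space). -/
theorem idTest_map_conj {H₁ H₂ H₃ : Subgroup (GLm p 2)} (c : GLm p 2)
    (h : ∃ f ∈ levelSubmodule p 2 1, f 1 = 1 ∧
      ∀ a ∈ H₁, ∀ b ∈ H₂, ∀ g ∈ H₃, a * b * g ≠ 1 → f (a * b * g) = 0) :
    ∃ f ∈ levelSubmodule p 2 1, f 1 = 1 ∧
      ∀ a ∈ H₁.map (MulAut.conj c⁻¹).toMonoidHom, ∀ b ∈ H₂.map (MulAut.conj c⁻¹).toMonoidHom,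
        ∀ g ∈ H₃.map (MulAut.conj c⁻¹).toMonoidHom, a * b * g ≠ 1 → f (a * b * g) = 0 := by
  obtain ⟨f, hf, hf1, hf0⟩ := h
  refine ⟨fun x => f (c * x * c⁻¹), levelSubmodule_bi_inv f hf c c⁻¹, by simpa using hf1, ?_⟩
  intro a ha b hb g hg hne
  rw [mem_map_conj_inv_iff] at ha hb hg
  have hne' : (c * a * c⁻¹) * (c * b * c⁻¹) * (c * g * c⁻¹) ≠ 1 := by
    intro h1
    apply hne
    have h2 : c * (a * b * g) * c⁻¹ = 1 := by rw [← h1]; group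
    have h3 := congrArg (fun y => c⁻¹ * y * c) h2
    simpa [mul_assoc] using h3
  have := hf0 _ ha _ hb _ hg hne'
  show f (c * (a * b * g) * c⁻¹) = 0
  convert this using 2
  group

/-- The diagonal part of an upper-triangular member lies in the member when `U⁺` does. -/
theorem exists_diag_mem_of_upper {H : Subgroup (GLm p 2)}
    (hU : ∀ u : GLm p 2, (u : Mat p 2) 1 0 = 0 → (u : Mat p 2) 0 0 = 1 → (u : Mat p 2) 1 1 = 1 →
      u ∈ H)
    {k : GLm p 2} (hk : k ∈ H) (hk10 : (k : Mat p 2) 1 0 = 0) :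
    ∃ t ∈ H, (t : Mat p 2) = !![(k : Mat p 2) 0 0, 0; 0, (k : Mat p 2) 1 1] := by
  have hk00 : (k : Mat p 2) 0 0 ≠ 0 := by
    have h := Matrix.GeneralLinearGroup.det_ne_zero k
    rw [Matrix.det_fin_two, hk10, mul_zero, sub_zero] at h
    exact left_ne_zero_of_mul h
  obtain ⟨u, hu⟩ :
      ∃ u : GLm p 2, (u : Mat p 2) = !![1, -(k : Mat p 2) 0 1 / (k : Mat p 2) 0 0; 0, 1] :=
    ⟨Matrix.GeneralLinearGroup.mkOfDetNeZero _ (by rw [Matrix.det_fin_two_of]; simp), rfl⟩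
  refine ⟨k * u, H.mul_mem hk (hU u (by simp [hu]) (by simp [hu]) (by simp [hu])), ?_⟩
  rw [Units.val_mul, Matrix.eta_fin_two (k : Mat p 2), hu, hk10, Matrix.mul_fin_two]
  ext i j
  fin_cases i <;> fin_cases j <;> simp
  field_simp
  ring

/-- The diagonal part of a lower-triangular member lies in the member when `U⁻` does. -/
theorem exists_diag_mem_of_lower {H : Subgroup (GLm p 2)}
    (hL : ∀ v : GLm p 2, (v : Mat p 2) 0 1 = 0 → (v : Mat p 2) 0 0 = 1 → (v : Mat p 2) 1 1 = 1 →
      v ∈ H)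
    {k : GLm p 2} (hk : k ∈ H) (hk01 : (k : Mat p 2) 0 1 = 0) :
    ∃ t ∈ H, (t : Mat p 2) = !![(k : Mat p 2) 0 0, 0; 0, (k : Mat p 2) 1 1] := by
  have hk11 : (k : Mat p 2) 1 1 ≠ 0 := by
    have h := Matrix.GeneralLinearGroup.det_ne_zero k
    rw [Matrix.det_fin_two, hk01, zero_mul, sub_zero] at h
    exact right_ne_zero_of_mul h
  obtain ⟨v, hv⟩ :
      ∃ v : GLm p 2, (v : Mat p 2) = !![1, 0; -(k : Mat p 2) 1 0 / (k : Mat p 2) 1 1, 1] :=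
    ⟨Matrix.GeneralLinearGroup.mkOfDetNeZero _ (by rw [Matrix.det_fin_two_of]; simp), rfl⟩
  refine ⟨k * v, H.mul_mem hk (hL v (by simp [hv]) (by simp [hv]) (by simp [hv])), ?_⟩
  rw [Units.val_mul, Matrix.eta_fin_two (k : Mat p 2), hv, hk01, Matrix.mul_fin_two]
  ext i j
  fin_cases i <;> fin_cases j <;> simp
  field_simp
  ring

/-- Product of two elements with diagonal matrices. -/
theorem coe_mul_of_diag {s t : GLm p 2} {x₀ x₁ y₀ y₁ : ZMod p}
    (hs : (s : Mat p 2) = !![x₀, 0; 0, x₁]) (ht : (t : Mat p 2) = !![y₀, 0; 0, y₁]) :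
    ((s * t : GLm p 2) : Mat p 2) = !![x₀ * y₀, 0; 0, x₁ * y₁] := by
  rw [Units.val_mul, hs, ht, Matrix.mul_fin_two]
  simp

/-- **KERNEL LAW (frame version).**  In a Borel frame (`H₁ ≤ B⁺ ⊇ U⁺`, `H₂ ≤ B⁻ ⊇ U⁻`), a
subgroup-TPP triple with a level-1 identity test has diagonal data meeting at most one coordinate
kernel: `a₁₁b₁₁ = 1 ⇒ a₀₀b₀₀ = 1` for all `a ∈ H₁, b ∈ H₂`, or `a₀₀b₀₀ = 1 ⇒ a₁₁b₁₁ = 1` for all. -/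
theorem kernel_law_frame {H₁ H₂ H₃ : Subgroup (GLm p 2)} (htpp : SubgroupTPP H₁ H₂ H₃)
    (hB₁ : ∀ k ∈ H₁, (k : Mat p 2) 1 0 = 0)
    (hU₁ : ∀ u : GLm p 2, (u : Mat p 2) 1 0 = 0 → (u : Mat p 2) 0 0 = 1 → (u : Mat p 2) 1 1 = 1 →
      u ∈ H₁)
    (hB₂ : ∀ k ∈ H₂, (k : Mat p 2) 0 1 = 0)
    (hU₂ : ∀ v : GLm p 2, (v : Mat p 2) 0 1 = 0 → (v : Mat p 2) 0 0 = 1 → (v : Mat p 2) 1 1 = 1 →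
      v ∈ H₂)
    (hdesign : ∃ f ∈ levelSubmodule p 2 1, f 1 = 1 ∧
      ∀ a ∈ H₁, ∀ b ∈ H₂, ∀ c ∈ H₃, a * b * c ≠ 1 → f (a * b * c) = 0) :
    (∀ a ∈ H₁, ∀ b ∈ H₂, (a : Mat p 2) 1 1 * (b : Mat p 2) 1 1 = 1 →
        (a : Mat p 2) 0 0 * (b : Mat p 2) 0 0 = 1) ∨
      (∀ a ∈ H₁, ∀ b ∈ H₂, (a : Mat p 2) 0 0 * (b : Mat p 2) 0 0 = 1 →
        (a : Mat p 2) 1 1 * (b : Mat p 2) 1 1 = 1) := by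
  by_contra hcon
  rw [not_or] at hcon
  obtain ⟨h₁, h₂⟩ := hcon
  push Not at h₁ h₂
  obtain ⟨a, ha, b, hb, hab1, hab0⟩ := h₁
  obtain ⟨a', ha', b', hb', hab0', hab1'⟩ := h₂
  -- diagonal parts
  obtain ⟨ta, hta, hta'⟩ := exists_diag_mem_of_upper hU₁ ha (hB₁ a ha)
  obtain ⟨tb, htb, htb'⟩ := exists_diag_mem_of_lower hU₂ hb (hB₂ b hb)
  obtain ⟨ta', hta2, hta2'⟩ := exists_diag_mem_of_upper hU₁ ha' (hB₁ a' ha')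
  obtain ⟨tb', htb2, htb2'⟩ := exists_diag_mem_of_lower hU₂ hb' (hB₂ b' hb')
  -- the grid values
  have he0 : (a : Mat p 2) 0 0 * (b : Mat p 2) 0 0 ≠ 0 := by
    have h := Matrix.GeneralLinearGroup.det_ne_zero (ta * tb)
    rwa [coe_mul_of_diag hta' htb', Matrix.det_fin_two_of, hab1, mul_one, mul_zero,
      sub_zero] at h
  have hd0 : (a' : Mat p 2) 1 1 * (b' : Mat p 2) 1 1 ≠ 0 := by
    have h := Matrix.GeneralLinearGroup.det_ne_zero (ta' * tb')
    rwa [coe_mul_of_diag hta2' htb2', Matrix.det_fin_two_of, hab0', one_mul, mul_zero,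
      sub_zero] at h
  have hgrid : ∀ ε δ : ZMod p,
      (ε = 1 ∨ ε = (a : Mat p 2) 0 0 * (b : Mat p 2) 0 0) →
      (δ = 1 ∨ δ = (a' : Mat p 2) 1 1 * (b' : Mat p 2) 1 1) →
      ∃ x ∈ H₁, ∃ y ∈ H₂, ((x * y : GLm p 2) : Mat p 2) = !![ε, 0; 0, δ] := by
    rintro ε δ (rfl | rfl) (rfl | rfl)
    · exact ⟨1, H₁.one_mem, 1, H₂.one_mem, by
        rw [mul_one, Units.val_one]; ext i j; fin_cases i <;> fin_cases j <;> simp⟩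
    · exact ⟨ta', hta2, tb', htb2, by rw [coe_mul_of_diag hta2' htb2', hab0']⟩
    · exact ⟨ta, hta, tb, htb, by rw [coe_mul_of_diag hta' htb', hab1]⟩
    · refine ⟨ta * ta', H₁.mul_mem hta hta2, tb * tb', H₂.mul_mem htb htb2, ?_⟩
      rw [coe_mul_of_diag (coe_mul_of_diag hta' hta2') (coe_mul_of_diag htb' htb2')]
      have e1 : (a : Mat p 2) 0 0 * (a' : Mat p 2) 0 0 * ((b : Mat p 2) 0 0 * (b' : Mat p 2) 0 0)
          = (a : Mat p 2) 0 0 * (b : Mat p 2) 0 0 := by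
        rw [mul_mul_mul_comm, hab0', mul_one]
      have e2 : (a : Mat p 2) 1 1 * (a' : Mat p 2) 1 1 * ((b : Mat p 2) 1 1 * (b' : Mat p 2) 1 1)
          = (a' : Mat p 2) 1 1 * (b' : Mat p 2) 1 1 := by
        rw [mul_mul_mul_comm, hab1, one_mul]
      rw [e1, e2]
  exact no_idTest_grid_up₁_lo₂ htpp he0 hab0 hd0 hab1' hU₁ hU₂ hgrid hdesign

/-- **KERNEL LAW (two p-members).**  A subgroup-TPP triple `(H₁, H₂, H₃)` of `GL_2(𝔽_p)` with
`p ∣ |H₁|`, `p ∣ |H₂|` and a level-1 identity test has a Borel frame `c` (`c⁻¹H₁c ≤ B⁺ ⊇ U⁺`,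
`c⁻¹H₂c ≤ B⁻ ⊇ U⁻`) in which the diagonal data meets at most one coordinate kernel. -/
theorem kernel_law_of_two_pMembers {H₁ H₂ H₃ : Subgroup (GLm p 2)} (htpp : SubgroupTPP H₁ H₂ H₃)
    (h₁ : p ∣ Nat.card H₁) (h₂ : p ∣ Nat.card H₂)
    (hdesign : ∃ f ∈ levelSubmodule p 2 1, f 1 = 1 ∧
      ∀ a ∈ H₁, ∀ b ∈ H₂, ∀ c ∈ H₃, a * b * c ≠ 1 → f (a * b * c) = 0) :
    ∃ c : GLm p 2,
      (∀ k ∈ H₁.map (MulAut.conj c⁻¹).toMonoidHom, (k : Mat p 2) 1 0 = 0) ∧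
      (∀ u : GLm p 2, (u : Mat p 2) 1 0 = 0 → (u : Mat p 2) 0 0 = 1 → (u : Mat p 2) 1 1 = 1 →
        u ∈ H₁.map (MulAut.conj c⁻¹).toMonoidHom) ∧
      (∀ k ∈ H₂.map (MulAut.conj c⁻¹).toMonoidHom, (k : Mat p 2) 0 1 = 0) ∧
      (∀ u : GLm p 2, (u : Mat p 2) 0 1 = 0 → (u : Mat p 2) 0 0 = 1 → (u : Mat p 2) 1 1 = 1 →
        u ∈ H₂.map (MulAut.conj c⁻¹).toMonoidHom) ∧
      ((∀ a ∈ H₁.map (MulAut.conj c⁻¹).toMonoidHom, ∀ b ∈ H₂.map (MulAut.conj c⁻¹).toMonoidHom,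
          (a : Mat p 2) 1 1 * (b : Mat p 2) 1 1 = 1 → (a : Mat p 2) 0 0 * (b : Mat p 2) 0 0 = 1) ∨
        (∀ a ∈ H₁.map (MulAut.conj c⁻¹).toMonoidHom, ∀ b ∈ H₂.map (MulAut.conj c⁻¹).toMonoidHom,
          (a : Mat p 2) 0 0 * (b : Mat p 2) 0 0 = 1 →
            (a : Mat p 2) 1 1 * (b : Mat p 2) 1 1 = 1)) := by
  obtain ⟨c, hB₁, hU₁, hB₂, hU₂, htpp'⟩ := exists_borel_frame_of_tpp htpp h₁ h₂
  exact ⟨c, hB₁, hU₁, hB₂, hU₂,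
    kernel_law_frame htpp' hB₁ hU₁ hB₂ hU₂ (idTest_map_conj c hdesign)⟩

/-- **KERNEL LAW in the crux's vocabulary.**  If `(H₁, H₂, H₃)` is subgroup-TPP with
`p ∣ |H₁|`, `p ∣ |H₂|` and satisfies the identity-design clause of `SubgroupIdentityDesigns` at
level `k = 1`, then in a Borel frame the diagonal data of `(c⁻¹H₁c, c⁻¹H₂c)` meets at most one
coordinate kernel. -/
theorem kernel_law_of_levelOne_design {H₁ H₂ H₃ : Subgroup (GLm p 2)}
    (htpp : SubgroupTPP H₁ H₂ H₃) (h₁ : p ∣ Nat.card H₁) (h₂ : p ∣ Nat.card H₂)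
    (hdesign : ∃ c : Mat p 2 → ℂ, (∀ M, 1 < M.rank → c M = 0) ∧
      (∑ M, c M * ZMod.stdAddChar (Matrix.trace (M * ((1 : GLm p 2) : Mat p 2)))) = 1 ∧
      ∀ a ∈ H₁, ∀ b ∈ H₂, ∀ g ∈ H₃, a * b * g ≠ 1 →
        (∑ M, c M *
          ZMod.stdAddChar (Matrix.trace (M * ((a * b * g : GLm p 2) : Mat p 2)))) = 0) :
    ∃ c : GLm p 2,
      (∀ k ∈ H₁.map (MulAut.conj c⁻¹).toMonoidHom, (k : Mat p 2) 1 0 = 0) ∧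
      (∀ u : GLm p 2, (u : Mat p 2) 1 0 = 0 → (u : Mat p 2) 0 0 = 1 → (u : Mat p 2) 1 1 = 1 →
        u ∈ H₁.map (MulAut.conj c⁻¹).toMonoidHom) ∧
      (∀ k ∈ H₂.map (MulAut.conj c⁻¹).toMonoidHom, (k : Mat p 2) 0 1 = 0) ∧
      (∀ u : GLm p 2, (u : Mat p 2) 0 1 = 0 → (u : Mat p 2) 0 0 = 1 → (u : Mat p 2) 1 1 = 1 →
        u ∈ H₂.map (MulAut.conj c⁻¹).toMonoidHom) ∧
      ((∀ a ∈ H₁.map (MulAut.conj c⁻¹).toMonoidHom, ∀ b ∈ H₂.map (MulAut.conj c⁻¹).toMonoidHom,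
          (a : Mat p 2) 1 1 * (b : Mat p 2) 1 1 = 1 → (a : Mat p 2) 0 0 * (b : Mat p 2) 0 0 = 1) ∨
        (∀ a ∈ H₁.map (MulAut.conj c⁻¹).toMonoidHom, ∀ b ∈ H₂.map (MulAut.conj c⁻¹).toMonoidHom,
          (a : Mat p 2) 0 0 * (b : Mat p 2) 0 0 = 1 →
            (a : Mat p 2) 1 1 * (b : Mat p 2) 1 1 = 1)) := by
  obtain ⟨c, hc, hc1, hc0⟩ := hdesign
  exact kernel_law_of_two_pMembers htpp h₁ h₂
    ⟨fourierFn c, LevelOneGL2Designs.Negative.fourierFn_mem_levelSubmodule hc, hc1,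
      fun a ha b hb g hg hne => hc0 a ha b hb g hg hne⟩

end KernelLaw

end Summit.MatrixMultiplication.MatrixMultiplication.Theorems.SubgroupIdentityDesigns.Negative

end
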